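import Summits.KontsevichZagierPeriods.Zeta5Search.TwoTaleP15CommonCells
import Literature.NumberTheory.DiophantineApproximation.DilogLandenLinearIndependenceRates

/-!
# P15, the (bmiss)-free route W1: `p_n = −p̂_n` eventually from ONE input, the second-tale decay `DecayT c′`

HONEST FRAMING: systematic search; no irrationality claim unless certified.  NOTHING about `ζ(2)` is certified
here beyond the tree's facts: the measure statement below is an IMPLICATION from the named input
`Denom.TwoTaleP15Coincidence.DecayT c′` (decay of Zudilin's second tale at the Remark-5 partner of P15, design value
`29.10787`, being formalised by fam-measure g5 as U2), which is NOT a tree theorem.  If and when `DecayT c′` lands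
for some `c′ ≥ 25.5`, `zetaTwo_exponent_le_of_decayT_W1` gives `ExponentLE (zetaValue 2) 5.0499` with no
hypothesis; until then the P15 value stays CONDITIONAL and is not a claim.

Cell pub-zeta5, P1 g10 (`pub-zeta5-p1/TWODECAY-ROUTE-g10.md`), built on fam-denom g7's `Denom/TwoTaleP15Coincidence`
(files 44–46).  Compared with `zetaTwo_exponent_le_of_topWindowT : DecayT 28.462 → Prop3T → TopWindowT → …`
(three inputs) this file needs `DecayT` ONLY: the arithmetic inputs are replaced by TREE THEOREMS —
`N_n p̂_n ∈ ℤ` with `N_n = D_{17n}²·E_n²` (`TwoTaleP15CommonCells.exists_int_bigN_mul_formPT`: slice lemma for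
`p > 17n`, free bound `p²` on `(√26n, 17n]`, crude bound below `√26n`), rate `34 + o(1)`; and EIGHT common prime
cells (`TwoTaleP15CommonCells.pow_dvd_sum_*`) whose product `Π_n` has rate
`R = Σ_cells ℓ·(ψ(v) − ψ(u)) = 8.76… ≥ 8.65` (`W1rate_ge`).  Mechanism (PROVED, `pCoincidence_eventually_W1`):
Whipple `q_n = −q̂_n` (tree) ⇒ `|p_n + p̂_n| ≤ e^{−29.10787n} + e^{−c′n}`; the INTEGER `N_n(p_n + p̂_n) =
Q_n·D₁₆ₙD₁₅ₙp_n + N_n p̂_n` is divisible by `Π_n ≥ e^{(8.65)n}` and has absolute value `≤ e^{(34+ε)n}·2e^{−min(c′,29.10787)n}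
< Π_n` once `min(c′, 29.10787) > 34 − 8.65`; hence it vanishes.  The eventual coincidence feeds fam-denom's
`zetaTwo_exponent_le_of_eventual_pCoincidence`.  The value `5.0499` WOULD be below the printed record
`5.09541178` [Zudilin 2014, Thm 1]; it is NOT claimed here.
-/

noncomputable section

open Filter Topology Finset
open Literature.NumberTheory.Irrationality.Zudilin2014
open Literature.NumberTheory.Transcendental (zetaValue)
open Literature.NumberTheory.DiophantineApproximation.RhinViola (classPrimes classPrimeProduct classPrimeProduct_pos
  prime_of_mem_classPrimes tendsto_log_classPrimeProduct_div summable_densityTerm)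
open Literature.NumberTheory.DiophantineApproximation.ViolaZudilin (tendsto_log_lcmUpto_mul_lcmUpto_div)
open Summit.KontsevichZagierPeriods.Zeta5Search (eventually_le_exp_mul_of_tendsto_log_div
  eventually_exp_mul_le_of_tendsto_log_div)
open Summit.KontsevichZagierPeriods.Zeta5Search.TwoTaleP15
open Summit.KontsevichZagierPeriods.Zeta5Search.Denom.TwoTaleP15Saving (primeCut)
open Summit.KontsevichZagierPeriods.Zeta5Search.Denom.TwoTaleP15Forms (lcmNormaliser lcmNormaliser_pos)
open Summit.KontsevichZagierPeriods.Zeta5Search.Denom.TwoTaleP15Coincidence (DecayT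
  zetaTwo_exponent_le_of_eventual_pCoincidence)
open Summit.KontsevichZagierPeriods.Zeta5Search.Denom.TwoTaleP15TopWindow (fudge fudge_pos fudge_le_exp)
open Summit.KontsevichZagierPeriods.Zeta5Search.TwoTaleP15CommonCells

namespace Summit.KontsevichZagierPeriods.Zeta5Search.TwoTaleP15CoincidenceW1

/-! ### One cell: product, block, rate -/

/-- The class-prime product of the cell `[u,v)`: `∏ {p prime : p ≤ 15n, 26n < p², u ≤ {n/p} < v}`. -/
def cellProd (u v : ℝ) (n : ℕ) : ℕ := classPrimeProduct 26 primeCut {(u, v)} n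

/-- `cellProd u v n > 0`. -/
theorem cellProd_pos (u v : ℝ) (n : ℕ) : 0 < cellProd u v n := classPrimeProduct_pos _ _ _ _

/-- `cellProd` is the plain product over the class. -/
theorem cellProd_eq (u v : ℝ) (n : ℕ) : cellProd u v n = ∏ p ∈ classPrimes 26 primeCut (u, v) n, p := by
  simp [cellProd, classPrimeProduct, Finset.singleton_biUnion]

/-- Membership unpacked. -/
theorem hyps_of_mem {u v : ℝ} {n p : ℕ} (h : p ∈ classPrimes 26 primeCut (u, v) n) :
    p.Prime ∧ 26 * n < p ^ 2 ∧ u ≤ Int.fract ((n : ℝ) / p) ∧ Int.fract ((n : ℝ) / p) < v := by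
  simp only [classPrimes, mem_filter, mem_range] at h
  obtain ⟨-, hp, h2, h3, h4⟩ := h
  exact ⟨hp, by exact_mod_cast h2, h3, h4⟩

/-- **Block divisibility**: if `p^ℓ ∣ M` for every prime of the cell, then `(cellProd u v n)^ℓ ∣ M`. -/
theorem cellProd_pow_dvd {u v : ℝ} {n ℓ : ℕ} {M : ℤ}
    (h : ∀ p ∈ classPrimes 26 primeCut (u, v) n, (p : ℤ) ^ ℓ ∣ M) : ((cellProd u v n : ℕ) : ℤ) ^ ℓ ∣ M := by
  rw [cellProd_eq, Nat.cast_prod, ← prod_pow]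
  refine Finset.prod_dvd_of_coprime (fun p hp q hq hpq => ?_) h
  exact (Nat.isCoprime_iff_coprime.2 (Nat.coprime_pow_primes _ _ (prime_of_mem_classPrimes hp)
    (prime_of_mem_classPrimes hq) hpq)) |> fun hc => by simpa [Nat.cast_pow] using hc

/-- **Blocks of separated cells are coprime.** -/
theorem isCoprime_cellProd_pow {u v u' v' : ℝ} (hsep : v ≤ u' ∨ v' ≤ u) (n ℓ ℓ' : ℕ) :
    IsCoprime (((cellProd u v n : ℕ) : ℤ) ^ ℓ) (((cellProd u' v' n : ℕ) : ℤ) ^ ℓ') := by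
  refine IsCoprime.pow ?_
  rw [cellProd_eq, cellProd_eq, Nat.cast_prod, Nat.cast_prod]
  refine IsCoprime.prod_left fun p hp => IsCoprime.prod_right fun q hq => ?_
  obtain ⟨hpP, -, hu, hv⟩ := hyps_of_mem hp
  obtain ⟨hqP, -, hu', hv'⟩ := hyps_of_mem hq
  have hne : p ≠ q := by
    rintro rfl
    rcases hsep with h | h <;> linarith
  exact Nat.isCoprime_iff_coprime.2 ((Nat.coprime_primes hpP hqP).2 hne)

/-- **Rate of one cell**: `(1/n) log cellProd u v n → Σ_k (1/(k+u) − 1/(k+v)) = ψ(v) − ψ(u)` for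
`1/15 ≤ u < v ≤ 1`. -/
theorem tendsto_log_cellProd_div {u v : ℝ} (hu : 1 / 15 ≤ u) (huv : u < v) (hv : v ≤ 1) :
    Tendsto (fun n : ℕ => Real.log (cellProd u v n) / n) atTop
      (𝓝 (∑' k : ℕ, (1 / ((k : ℝ) + u) - 1 / ((k : ℝ) + v)))) := by
  have hu0 : 0 < u := lt_of_lt_of_le (by norm_num) hu
  have h := tendsto_log_classPrimeProduct_div (C := 26) (by norm_num) primeCut {(u, v)}
    (fun I hI => by rw [mem_singleton] at hI; subst hI; exact ⟨hu0, huv, hv⟩)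
    (fun I hI n => by
      rw [mem_singleton] at hI; subst hI
      show (n : ℝ) / u ≤ (primeCut n : ℝ)
      rw [Denom.TwoTaleP15Saving.primeCut]; push_cast
      rw [div_le_iff₀ hu0]; nlinarith [Nat.cast_nonneg (α := ℝ) n])
    (fun I hI I' hI' hne => by rw [mem_singleton] at hI hI'; exact absurd (hI.trans hI'.symm) hne)
  simpa only [sum_singleton, cellProd] using h

/-- A certified lower bound for one cell rate from three terms of the (nonnegative) series. -/
theorem cellRate_ge {u v c : ℝ} (hu : 0 < u) (huv : u < v) (hv1 : v ≤ u + 1)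
    (hc : c ≤ ∑ k ∈ range 3, (1 / ((k : ℝ) + u) - 1 / ((k : ℝ) + v))) :
    c ≤ ∑' k : ℕ, (1 / ((k : ℝ) + u) - 1 / ((k : ℝ) + v)) :=
  hc.trans (Summable.sum_le_tsum (range 3)
    (fun k _ => sub_nonneg.2 (one_div_le_one_div_of_le (by positivity) (by linarith)))
    (summable_densityTerm hu huv.le hv1))

/-! ### The W1 product `Π_n` (eight cells, levels 1,1,2,1,2,1,1,2) and its rate -/

/-- **`Π_n`** = product of the eight cell products, the level-2 cells squared. -/
def W1prod (n : ℕ) : ℕ :=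
  cellProd (1/11) (2/17) n * cellProd (2/17) (3/17) n * cellProd (2/11) (1/5) n ^ 2 * cellProd (1/5) (3/13) n
    * cellProd (3/11) (5/17) n ^ 2 * cellProd (5/17) (4/13) n * cellProd (4/13) (6/17) n * cellProd (4/11) (5/13) n ^ 2

/-- `Π_n > 0`. -/
theorem W1prod_pos (n : ℕ) : 0 < W1prod n := by
  unfold W1prod
  have h := cellProd_pos
  exact Nat.mul_pos (Nat.mul_pos (Nat.mul_pos (Nat.mul_pos (Nat.mul_pos (Nat.mul_pos (Nat.mul_pos (h _ _ n) (h _ _ n))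
    (pow_pos (h _ _ n) 2)) (h _ _ n)) (pow_pos (h _ _ n) 2)) (h _ _ n)) (h _ _ n)) (pow_pos (h _ _ n) 2)

/-- The rate of one cell as a function of the endpoints. -/
def rate (u v : ℝ) : ℝ := ∑' k : ℕ, (1 / ((k : ℝ) + u) - 1 / ((k : ℝ) + v))

/-- **The W1 rate** `R = Σ_cells ℓ·(ψ(v) − ψ(u))` (`= 8.7610…`). -/
def W1rate : ℝ :=
  rate (1/11) (2/17) + rate (2/17) (3/17) + 2 * rate (2/11) (1/5) + rate (1/5) (3/13)
    + 2 * rate (3/11) (5/17) + rate (5/17) (4/13) + rate (4/13) (6/17) + 2 * rate (4/11) (5/13)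

/-- **`R ≥ 8.65`** (three terms of each series; the model value is `8.7610…`). -/
theorem W1rate_ge : (8.65 : ℝ) ≤ W1rate := by
  have h1 := cellRate_ge (u := 1/11) (v := 2/17) (c := 2.5279684) (by norm_num) (by norm_num) (by norm_num)
    (by norm_num [sum_range_succ, sum_range_zero])
  have h2 := cellRate_ge (u := 2/17) (v := 3/17) (c := 2.8908329) (by norm_num) (by norm_num) (by norm_num)
    (by norm_num [sum_range_succ, sum_range_zero])
  have h3 := cellRate_ge (u := 2/11) (v := 1/5) (c := 0.5166083) (by norm_num) (by norm_num) (by norm_num)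
    (by norm_num [sum_range_succ, sum_range_zero])
  have h4 := cellRate_ge (u := 1/5) (v := 3/13) (c := 0.6937695) (by norm_num) (by norm_num) (by norm_num)
    (by norm_num [sum_range_succ, sum_range_zero])
  have h5 := cellRate_ge (u := 3/11) (v := 5/17) (c := 0.2837562) (by norm_num) (by norm_num) (by norm_num)
    (by norm_num [sum_range_succ, sum_range_zero])
  have h6 := cellRate_ge (u := 5/17) (v := 4/13) (c := 0.1605854) (by norm_num) (by norm_num) (by norm_num)
    (by norm_num [sum_range_succ, sum_range_zero])
  have h7 := cellRate_ge (u := 4/13) (v := 6/17) (c := 0.4505754) (by norm_num) (by norm_num) (by norm_num)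
    (by norm_num [sum_range_succ, sum_range_zero])
  have h8 := cellRate_ge (u := 4/11) (v := 5/13) (c := 0.1648331) (by norm_num) (by norm_num) (by norm_num)
    (by norm_num [sum_range_succ, sum_range_zero])
  unfold W1rate rate
  linarith

/-- **Rate of `Π_n`**: `(1/n) log Π_n → R`. -/
theorem tendsto_log_W1prod_div : Tendsto (fun n : ℕ => Real.log (W1prod n) / n) atTop (𝓝 W1rate) := by
  have t1 := tendsto_log_cellProd_div (u := 1/11) (v := 2/17) (by norm_num) (by norm_num) (by norm_num)
  have t2 := tendsto_log_cellProd_div (u := 2/17) (v := 3/17) (by norm_num) (by norm_num) (by norm_num)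
  have t3 := tendsto_log_cellProd_div (u := 2/11) (v := 1/5) (by norm_num) (by norm_num) (by norm_num)
  have t4 := tendsto_log_cellProd_div (u := 1/5) (v := 3/13) (by norm_num) (by norm_num) (by norm_num)
  have t5 := tendsto_log_cellProd_div (u := 3/11) (v := 5/17) (by norm_num) (by norm_num) (by norm_num)
  have t6 := tendsto_log_cellProd_div (u := 5/17) (v := 4/13) (by norm_num) (by norm_num) (by norm_num)
  have t7 := tendsto_log_cellProd_div (u := 4/13) (v := 6/17) (by norm_num) (by norm_num) (by norm_num)
  have t8 := tendsto_log_cellProd_div (u := 4/11) (v := 5/13) (by norm_num) (by norm_num) (by norm_num)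
  have h := ((((((t1.add t2).add (t3.const_mul 2)).add t4).add (t5.const_mul 2)).add t6).add t7).add
    (t8.const_mul 2)
  unfold W1rate rate
  refine h.congr fun n => ?_
  have h1 : (0 : ℝ) < cellProd (1/11) (2/17) n := by exact_mod_cast cellProd_pos _ _ n
  have h2 : (0 : ℝ) < cellProd (2/17) (3/17) n := by exact_mod_cast cellProd_pos _ _ n
  have h3 : (0 : ℝ) < cellProd (2/11) (1/5) n := by exact_mod_cast cellProd_pos _ _ n
  have h4 : (0 : ℝ) < cellProd (1/5) (3/13) n := by exact_mod_cast cellProd_pos _ _ n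
  have h5 : (0 : ℝ) < cellProd (3/11) (5/17) n := by exact_mod_cast cellProd_pos _ _ n
  have h6 : (0 : ℝ) < cellProd (5/17) (4/13) n := by exact_mod_cast cellProd_pos _ _ n
  have h7 : (0 : ℝ) < cellProd (4/13) (6/17) n := by exact_mod_cast cellProd_pos _ _ n
  have h8 : (0 : ℝ) < cellProd (4/11) (5/13) n := by exact_mod_cast cellProd_pos _ _ n
  simp only [W1prod, Nat.cast_mul, Nat.cast_pow]
  rw [Real.log_mul, Real.log_mul, Real.log_mul, Real.log_mul, Real.log_mul, Real.log_mul, Real.log_mul,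
    Real.log_pow, Real.log_pow, Real.log_pow]
  · push_cast; ring
  all_goals positivity

/-- Eventually `e^{8.6 n} ≤ Π_n`. -/
theorem eventually_exp_le_W1prod : ∀ᶠ n : ℕ in atTop, Real.exp (8.6 * n) ≤ (W1prod n : ℝ) :=
  eventually_exp_mul_le_of_tendsto_log_div (f := fun n : ℕ => (W1prod n : ℝ))
    (fun n => by exact_mod_cast W1prod_pos n) tendsto_log_W1prod_div (by linarith [W1rate_ge])

/-! ### The size of the normaliser `N_n` -/

/-- Eventually `N_n ≤ e^{(34 + ε) n}`. -/
theorem eventually_bigN_le_exp {ε : ℝ} (hε : 0 < ε) :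
    ∀ᶠ n : ℕ in atTop, (bigN n : ℝ) ≤ Real.exp ((34 + ε) * n) := by
  have hD : Tendsto (fun n : ℕ => Real.log ((Nat.lcmUpto (17 * n) : ℝ) * Nat.lcmUpto (17 * n)) / n) atTop
      (𝓝 34) := by
    have := tendsto_log_lcmUpto_mul_lcmUpto_div (a := 17) (b := 17) (by norm_num) (by norm_num)
    norm_num at this; exact this
  have h1 := eventually_le_exp_mul_of_tendsto_log_div
    (f := fun n : ℕ => (Nat.lcmUpto (17 * n) : ℝ) * Nat.lcmUpto (17 * n))
    (fun n => by have := Nat.lcmUpto_pos (17 * n); positivity) hD (show (34 : ℝ) < 34 + ε / 2 by linarith)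
  have h2 := fudge_le_exp (show (0 : ℝ) < ε / 4 by linarith)
  filter_upwards [h1, h2] with n hn hF
  have hF0 : (0 : ℝ) ≤ fudge n := Nat.cast_nonneg _
  rw [bigN]; push_cast
  calc ((Nat.lcmUpto (17 * n) : ℝ) * Nat.lcmUpto (17 * n)) * ((fudge n : ℝ) * fudge n)
      ≤ Real.exp ((34 + ε / 2) * n) * (Real.exp (ε / 4 * n) * Real.exp (ε / 4 * n)) :=
        mul_le_mul hn (mul_le_mul hF hF hF0 (Real.exp_pos _).le) (mul_nonneg hF0 hF0) (Real.exp_pos _).le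
    _ = Real.exp ((34 + ε) * n) := by rw [← Real.exp_add, ← Real.exp_add]; congr 1; ring

/-! ### `Π_n` divides `N_n (p_n + p̂_n)` -/

/-- **`Π_n ∣ Q_n·D₁₆ₙD₁₅ₙp_n + N_n p̂_n`.** -/
theorem W1prod_dvd_sum {n : ℕ} (hn : 1 ≤ n) {z : ℤ} (hz : (bigN n : ℚ) * formPT (aT n) (bT n) = z) :
    (W1prod n : ℤ) ∣ (quot n : ℤ) * pP15num n + z := by
  set M : ℤ := (quot n : ℤ) * pP15num n + z with hM
  -- the eight blocks
  have d1 : ((cellProd (1/11) (2/17) n : ℕ) : ℤ) ^ 1 ∣ M := cellProd_pow_dvd fun p hp => by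
    obtain ⟨hpP, hp2, hu, hv⟩ := hyps_of_mem hp; exact pow_dvd_sum_cell9 hn hpP hp2 hu hv hz
  have d2 : ((cellProd (2/17) (3/17) n : ℕ) : ℤ) ^ 1 ∣ M := cellProd_pow_dvd fun p hp => by
    obtain ⟨hpP, hp2, hu, hv⟩ := hyps_of_mem hp; exact pow_dvd_sum_cellC hn hpP hp2 hu hv hz
  have d3 : ((cellProd (2/11) (1/5) n : ℕ) : ℤ) ^ 2 ∣ M := cellProd_pow_dvd fun p hp => by
    obtain ⟨hpP, hp2, hu, hv⟩ := hyps_of_mem hp; exact pow_dvd_sum_cell11 hn hpP hp2 hu hv hz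
  have d4 : ((cellProd (1/5) (3/13) n : ℕ) : ℤ) ^ 1 ∣ M := cellProd_pow_dvd fun p hp => by
    obtain ⟨hpP, hp2, hu, hv⟩ := hyps_of_mem hp; exact pow_dvd_sum_cellTc hn hpP hp2 hu hv hz
  have d5 : ((cellProd (3/11) (5/17) n : ℕ) : ℤ) ^ 2 ∣ M := cellProd_pow_dvd fun p hp => by
    obtain ⟨hpP, hp2, hu, hv⟩ := hyps_of_mem hp; exact pow_dvd_sum_cellTd hn hpP hp2 hu hv hz
  have d6 : ((cellProd (5/17) (4/13) n : ℕ) : ℤ) ^ 1 ∣ M := cellProd_pow_dvd fun p hp => by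
    obtain ⟨hpP, hp2, hu, hv⟩ := hyps_of_mem hp; exact pow_dvd_sum_cellTg hn hpP hp2 hu hv hz
  have d7 : ((cellProd (4/13) (6/17) n : ℕ) : ℤ) ^ 1 ∣ M := cellProd_pow_dvd fun p hp => by
    obtain ⟨hpP, hp2, hu, hv⟩ := hyps_of_mem hp; exact pow_dvd_sum_cellTe hn hpP hp2 hu hv hz
  have d8 : ((cellProd (4/11) (5/13) n : ℕ) : ℤ) ^ 2 ∣ M := cellProd_pow_dvd fun p hp => by
    obtain ⟨hpP, hp2, hu, hv⟩ := hyps_of_mem hp; exact pow_dvd_sum_cellTf hn hpP hp2 hu hv hz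
  -- pairwise coprimality from the separation of the cells (sorted: 1/11 < 2/17 < 3/17 < 2/11 < 1/5 < 3/13 <
  -- 3/11 < 5/17 < 4/13 < 6/17 < 4/11 < 5/13)
  have c12 := isCoprime_cellProd_pow (u := 1/11) (v := 2/17) (u' := 2/17) (v' := 3/17) (Or.inl le_rfl) n 1 1
  have c13 := isCoprime_cellProd_pow (u := 1/11) (v := 2/17) (u' := 2/11) (v' := 1/5) (Or.inl (by norm_num)) n 1 2
  have c14 := isCoprime_cellProd_pow (u := 1/11) (v := 2/17) (u' := 1/5) (v' := 3/13) (Or.inl (by norm_num)) n 1 1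
  have c15 := isCoprime_cellProd_pow (u := 1/11) (v := 2/17) (u' := 3/11) (v' := 5/17) (Or.inl (by norm_num)) n 1 2
  have c16 := isCoprime_cellProd_pow (u := 1/11) (v := 2/17) (u' := 5/17) (v' := 4/13) (Or.inl (by norm_num)) n 1 1
  have c17 := isCoprime_cellProd_pow (u := 1/11) (v := 2/17) (u' := 4/13) (v' := 6/17) (Or.inl (by norm_num)) n 1 1
  have c18 := isCoprime_cellProd_pow (u := 1/11) (v := 2/17) (u' := 4/11) (v' := 5/13) (Or.inl (by norm_num)) n 1 2
  have c23 := isCoprime_cellProd_pow (u := 2/17) (v := 3/17) (u' := 2/11) (v' := 1/5) (Or.inl (by norm_num)) n 1 2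
  have c24 := isCoprime_cellProd_pow (u := 2/17) (v := 3/17) (u' := 1/5) (v' := 3/13) (Or.inl (by norm_num)) n 1 1
  have c25 := isCoprime_cellProd_pow (u := 2/17) (v := 3/17) (u' := 3/11) (v' := 5/17) (Or.inl (by norm_num)) n 1 2
  have c26 := isCoprime_cellProd_pow (u := 2/17) (v := 3/17) (u' := 5/17) (v' := 4/13) (Or.inl (by norm_num)) n 1 1
  have c27 := isCoprime_cellProd_pow (u := 2/17) (v := 3/17) (u' := 4/13) (v' := 6/17) (Or.inl (by norm_num)) n 1 1
  have c28 := isCoprime_cellProd_pow (u := 2/17) (v := 3/17) (u' := 4/11) (v' := 5/13) (Or.inl (by norm_num)) n 1 2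
  have c34 := isCoprime_cellProd_pow (u := 2/11) (v := 1/5) (u' := 1/5) (v' := 3/13) (Or.inl le_rfl) n 2 1
  have c35 := isCoprime_cellProd_pow (u := 2/11) (v := 1/5) (u' := 3/11) (v' := 5/17) (Or.inl (by norm_num)) n 2 2
  have c36 := isCoprime_cellProd_pow (u := 2/11) (v := 1/5) (u' := 5/17) (v' := 4/13) (Or.inl (by norm_num)) n 2 1
  have c37 := isCoprime_cellProd_pow (u := 2/11) (v := 1/5) (u' := 4/13) (v' := 6/17) (Or.inl (by norm_num)) n 2 1
  have c38 := isCoprime_cellProd_pow (u := 2/11) (v := 1/5) (u' := 4/11) (v' := 5/13) (Or.inl (by norm_num)) n 2 2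
  have c45 := isCoprime_cellProd_pow (u := 1/5) (v := 3/13) (u' := 3/11) (v' := 5/17) (Or.inl (by norm_num)) n 1 2
  have c46 := isCoprime_cellProd_pow (u := 1/5) (v := 3/13) (u' := 5/17) (v' := 4/13) (Or.inl (by norm_num)) n 1 1
  have c47 := isCoprime_cellProd_pow (u := 1/5) (v := 3/13) (u' := 4/13) (v' := 6/17) (Or.inl (by norm_num)) n 1 1
  have c48 := isCoprime_cellProd_pow (u := 1/5) (v := 3/13) (u' := 4/11) (v' := 5/13) (Or.inl (by norm_num)) n 1 2
  have c56 := isCoprime_cellProd_pow (u := 3/11) (v := 5/17) (u' := 5/17) (v' := 4/13) (Or.inl le_rfl) n 2 1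
  have c57 := isCoprime_cellProd_pow (u := 3/11) (v := 5/17) (u' := 4/13) (v' := 6/17) (Or.inl (by norm_num)) n 2 1
  have c58 := isCoprime_cellProd_pow (u := 3/11) (v := 5/17) (u' := 4/11) (v' := 5/13) (Or.inl (by norm_num)) n 2 2
  have c67 := isCoprime_cellProd_pow (u := 5/17) (v := 4/13) (u' := 4/13) (v' := 6/17) (Or.inl le_rfl) n 1 1
  have c68 := isCoprime_cellProd_pow (u := 5/17) (v := 4/13) (u' := 4/11) (v' := 5/13) (Or.inl (by norm_num)) n 1 2
  have c78 := isCoprime_cellProd_pow (u := 4/13) (v := 6/17) (u' := 4/11) (v' := 5/13) (Or.inl (by norm_num)) n 1 2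
  -- assemble
  have e : (W1prod n : ℤ) = ((cellProd (1/11) (2/17) n : ℕ) : ℤ) ^ 1 * ((cellProd (2/17) (3/17) n : ℕ) : ℤ) ^ 1
      * ((cellProd (2/11) (1/5) n : ℕ) : ℤ) ^ 2 * ((cellProd (1/5) (3/13) n : ℕ) : ℤ) ^ 1
      * ((cellProd (3/11) (5/17) n : ℕ) : ℤ) ^ 2 * ((cellProd (5/17) (4/13) n : ℕ) : ℤ) ^ 1
      * ((cellProd (4/13) (6/17) n : ℕ) : ℤ) ^ 1 * ((cellProd (4/11) (5/13) n : ℕ) : ℤ) ^ 2 := by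
    rw [W1prod]; push_cast; ring
  rw [e]
  refine IsCoprime.mul_dvd ?_ (IsCoprime.mul_dvd ?_ (IsCoprime.mul_dvd ?_ (IsCoprime.mul_dvd ?_
    (IsCoprime.mul_dvd ?_ (IsCoprime.mul_dvd ?_ (IsCoprime.mul_dvd c12 d1 d2) d3) d4) d5) d6) d7) d8
  · exact ((((((c18.mul_left c28).mul_left c38).mul_left c48).mul_left c58).mul_left c68).mul_left c78)
  · exact (((((c17.mul_left c27).mul_left c37).mul_left c47).mul_left c57).mul_left c67)
  · exact ((((c16.mul_left c26).mul_left c36).mul_left c46).mul_left c56)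
  · exact (((c15.mul_left c25).mul_left c35).mul_left c45)
  · exact ((c14.mul_left c24).mul_left c34)
  · exact (c13.mul_left c23)

/-! ### The coincidence, eventually, from `DecayT` alone -/

/-- **`p_n = −p̂_n` for all large `n`, from `DecayT c′` with `c′ ≥ 25.5` (PROVED implication; `DecayT` is NOT
certified).** -/
theorem pCoincidence_eventually_W1 {c' : ℝ} (hDT : DecayT c') (hc' : (25.5 : ℝ) ≤ c') :
    ∀ᶠ n : ℕ in atTop, formP (aP15 n) (bP15 n) = -formPT (aT n) (bT n) := by
  have hW := TwoTaleWhipple.whippleP15_holds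
  have hdec : ∀ᶠ n : ℕ in atTop, |(Denom.TwoTaleP15Forms.formQ n : ℝ) * zetaValue 2 -
      (Denom.TwoTaleP15Forms.formP n : ℝ)| ≤ Real.exp (-(29.10787 * n)) :=
    Denom.TwoTaleP15DecayHolds.decay_holds_sharp
  have hDT' : ∀ᶠ n : ℕ in atTop, |(formQT (aT n) (bT n) : ℝ) * zetaValue 2 -
      (formPT (aT n) (bT n) : ℝ)| ≤ Real.exp (-(c' * n)) := hDT
  set m : ℝ := min c' 29.10787 with hm_def
  have hmc' : m ≤ c' := min_le_left _ _
  have hmc : m ≤ 29.10787 := min_le_right _ _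
  have hm : (25.5 : ℝ) ≤ m := le_min hc' (by norm_num)
  -- ε = 0.05: 34 + ε − m ≤ 8.55 < 8.6 − ... ; we use e^{εn} > 2
  have h2 : ∀ᶠ n : ℕ in atTop, (2 : ℝ) < Real.exp ((0.05 : ℝ) * n) := by
    have ht : Tendsto (fun n : ℕ => Real.exp ((0.05 : ℝ) * n)) atTop atTop :=
      Real.tendsto_exp_atTop.comp (tendsto_natCast_atTop_atTop.const_mul_atTop (by norm_num))
    exact ht.eventually_gt_atTop 2
  filter_upwards [hDT', hdec, eventually_exp_le_W1prod, eventually_bigN_le_exp (show (0:ℝ) < 0.05 by norm_num),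
    h2, eventually_ge_atTop 1] with n hrT hr hP hN h2n hn
  obtain ⟨z, hz⟩ := exists_int_bigN_mul_formPT hn
  have hn0 : (0 : ℝ) ≤ n := Nat.cast_nonneg n
  -- Whipple: `q_n = −q̂_n`
  have hq : (Denom.TwoTaleP15Forms.formQ n : ℝ) = -(formQT (aT n) (bT n) : ℝ) := by
    have e1 : formQ (aP15 n) (bP15 n) = (Denom.TwoTaleP15Forms.formQ n : ℚ) :=
      Denom.TwoTaleP15Bridge.formQ_eq hn
    have e2 := bmissQ_of_whipple hW hn
    rw [e1] at e2
    have e3 := congrArg (fun x : ℚ => (x : ℝ)) e2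
    push_cast at e3
    exact e3
  -- `|p_n + p̂_n| ≤ 2 e^{−m n}`
  have hx : |(Denom.TwoTaleP15Forms.formP n : ℝ) + (formPT (aT n) (bT n) : ℝ)| ≤
      2 * Real.exp (-(m * n)) := by
    have e : (Denom.TwoTaleP15Forms.formP n : ℝ) + (formPT (aT n) (bT n) : ℝ) =
        -(((Denom.TwoTaleP15Forms.formQ n : ℝ) * zetaValue 2 - Denom.TwoTaleP15Forms.formP n) +
          ((formQT (aT n) (bT n) : ℝ) * zetaValue 2 - formPT (aT n) (bT n))) := by
      rw [hq]; ring
    rw [e, abs_neg]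
    have i1 : Real.exp (-(29.10787 * n)) ≤ Real.exp (-(m * n)) :=
      Real.exp_le_exp.2 (neg_le_neg (mul_le_mul_of_nonneg_right hmc hn0))
    have i2 : Real.exp (-(c' * n)) ≤ Real.exp (-(m * n)) :=
      Real.exp_le_exp.2 (neg_le_neg (mul_le_mul_of_nonneg_right hmc' hn0))
    calc _ ≤ |(Denom.TwoTaleP15Forms.formQ n : ℝ) * zetaValue 2 - Denom.TwoTaleP15Forms.formP n| +
          |(formQT (aT n) (bT n) : ℝ) * zetaValue 2 - formPT (aT n) (bT n)| := abs_add_le _ _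
      _ ≤ 2 * Real.exp (-(m * n)) := by linarith
  -- the integer `N_n (p_n + p̂_n) = Q_n pP15num n + z`
  have hsumQ : (((quot n : ℤ) * pP15num n + z : ℤ) : ℚ) =
      (bigN n : ℚ) * (Denom.TwoTaleP15Forms.formP n + formPT (aT n) (bT n)) := by
    have hQ : ((quot n : ℤ) : ℚ) * (lcmNormaliser n : ℚ) = (bigN n : ℚ) := by exact_mod_cast quot_mul n
    rw [Int.cast_add, Int.cast_mul, ← pP15num_eq_formP hn, ← hz, ← hQ]; push_cast; ring
  have hsum : (((quot n : ℤ) * pP15num n + z : ℤ) : ℝ) =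
      (bigN n : ℝ) * ((Denom.TwoTaleP15Forms.formP n : ℝ) + (formPT (aT n) (bT n) : ℝ)) := by
    have e3 := congrArg (fun x : ℚ => (x : ℝ)) hsumQ
    push_cast at e3 ⊢
    linarith
  -- size `< Π_n`
  have hB0 : (0 : ℝ) < (bigN n : ℝ) := by exact_mod_cast bigN_pos n
  have hlt : |(((quot n : ℤ) * pP15num n + z : ℤ) : ℝ)| < (W1prod n : ℝ) := by
    rw [hsum, abs_mul, abs_of_pos hB0]
    have hexp : Real.exp ((34 + 0.05) * n) * (2 * Real.exp (-(m * n))) < Real.exp (8.6 * n) := by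
      have e1 : Real.exp ((34 + 0.05) * n) * (2 * Real.exp (-(m * n))) =
          2 * Real.exp ((34.05 - m) * n) := by
        rw [show (34.05 - m) * (n : ℝ) = (34 + 0.05) * n + -(m * n) by ring, Real.exp_add]; ring
      have e2 : Real.exp (8.6 * n) = Real.exp ((8.6 - (34.05 - m)) * n) * Real.exp ((34.05 - m) * n) := by
        rw [← Real.exp_add]; congr 1; ring
      rw [e1, e2]
      have hpos : 0 < Real.exp ((34.05 - m) * n) := Real.exp_pos _
      have hge : Real.exp ((0.05 : ℝ) * n) ≤ Real.exp ((8.6 - (34.05 - m)) * n) :=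
        Real.exp_le_exp.2 (mul_le_mul_of_nonneg_right (by linarith) hn0)
      have hg2 : 2 < Real.exp ((8.6 - (34.05 - m)) * n) := lt_of_lt_of_le h2n hge
      nlinarith [mul_pos (sub_pos.2 hg2) hpos]
    calc (bigN n : ℝ) * |(Denom.TwoTaleP15Forms.formP n : ℝ) + (formPT (aT n) (bT n) : ℝ)|
        ≤ Real.exp ((34 + 0.05) * n) * (2 * Real.exp (-(m * n))) :=
          mul_le_mul hN hx (abs_nonneg _) (Real.exp_pos _).le
      _ < Real.exp (8.6 * n) := hexp
      _ ≤ (W1prod n : ℝ) := hP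
  have hlt' : |(quot n : ℤ) * pP15num n + z| < (W1prod n : ℤ) := by exact_mod_cast hlt
  have h0 : (quot n : ℤ) * pP15num n + z = 0 := Int.eq_zero_of_abs_lt_dvd (W1prod_dvd_sum hn hz) hlt'
  -- conclude
  have hQ0 : (bigN n : ℚ) * (Denom.TwoTaleP15Forms.formP n + formPT (aT n) (bT n)) = 0 := by
    rw [← hsumQ, h0]; simp
  have hB0' : (bigN n : ℚ) ≠ 0 := by exact_mod_cast (bigN_pos n).ne'
  have hsum0 := (mul_eq_zero.1 hQ0).resolve_left hB0'
  rw [formP_eq_formP hn]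
  linarith

/-- **THE W1 ENDGAME: `DecayT c′ → 25.5 ≤ c′ → μ(ζ(2)) ≤ 5.0499` in the kernel's words** — `ExponentLE (zetaValue 2) 5.0499`
and Zudilin's printed form `zetaTwo_irrationalityExponent_le`.  PROVED implication; the input `DecayT c′` (second-tale
decay, design value `29.10787`) is NOT certified here, so NOTHING about `ζ(2)` is claimed. -/
theorem zetaTwo_exponent_le_of_decayT_W1 {c' : ℝ} (hDT : DecayT c') (hc' : (25.5 : ℝ) ≤ c') :
    ExponentLE (zetaValue 2) 5.0499 ∧ zetaTwo_irrationalityExponent_le :=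
  zetaTwo_exponent_le_of_eventual_pCoincidence (pCoincidence_eventually_W1 hDT hc')

end Summit.KontsevichZagierPeriods.Zeta5Search.TwoTaleP15CoincidenceW1

end
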